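import Summits.PneNP.PneNP.Theorems.KarlinRubinMonotoneBlindStubOrDisjoint

/-!
# Route KarlinRubin, crux `MonotoneBlind` (stmt-PneNP-18027), line `Sketch`: stub `stub_orDisjointFamily`

The finite-family version of the toy ACCUMULATION lemma `stub_orDisjoint` of line `Sketch`. For tests
`g i` (`i : Fin m`) determined by pairwise DISJOINT slot sets `S i` and a planted set `A`, the
dead–revival mass of `⋁ i, g i` at `A` (`x ∼ G(n,1/2)`, i.e. uniform on `EdgeVec n`) satisfies

  `Pr_x[(∀ i, g i x = false) ∧ ∃ i, g i (plant A x) = true]`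
  `  ≤ Σ_i Pr_x[g i x = false ∧ g i (plant A x) = true] · Pr_x[∀ j ≠ i, g j x = false]`.

Proof: take the witness `i` of the `∃`; the event is contained in
`⋃ i, ({g i dead ∧ g i revived} ∩ {every g j, j ≠ i, dead})`; union bound
(`MeasureTheory.measure_iUnion_fintype_le`); in the `i`-th intersection the first event is determined by
the slots `S i` (planting acts slot by slot, `apply_plant_congr_on`), the second by the slots
`T i := ⋃_{j ≠ i} S j` of the other children, and `S i ∩ T i = ∅` by pairwise disjointness
(`Finset.disjoint_biUnion_right`), so the two events are independent under the uniform edge vector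
(`erdosRenyiHalf_and_eq_mul_of_disjoint`, the binary case's product rule).

All `--supports stmt-PneNP-18027`; no definitions.
-/

set_option linter.dupNamespace false -- `Summit.PneNP.PneNP.…` is the layout-mandated namespace

namespace Summit.PneNP.PneNP.Theorems.MonotoneBlind.VertexCover

open Literature.Computability.Complexity Literature.Probability.RandomGraphs.PlantedClique Filter Finset
open scoped ENNReal Topology Classical

variable {n : ℕ}

/-! ### The slots of the other children -/

/-- For pairwise disjoint slot sets `S j`, the slots `S i` of the `i`-th child are disjoint from the
slots `⋃_{j ≠ i} S j` of the other children. [folklore] -/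
theorem disjoint_biUnion_others {m : ℕ} (S : Fin m → Finset (⊤ : SimpleGraph (Fin n)).edgeSet)
    (hS : ∀ i j, i ≠ j → Disjoint (S i) (S j)) (i : Fin m) :
    Disjoint (S i) ((univ.filter fun j => j ≠ i).biUnion S) := by
  rw [Finset.disjoint_biUnion_right]
  intro j hj
  exact hS i j (Ne.symm (Finset.mem_filter.1 hj).2)

/-- If every test `g j` is determined by the slots `S j`, then the event "every other child `g j`,
`j ≠ i`, is dead" is determined by the slots `⋃_{j ≠ i} S j`. [folklore] -/
theorem forall_ne_dead_congr_of_agree {m : ℕ} (S : Fin m → Finset (⊤ : SimpleGraph (Fin n)).edgeSet)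
    (g : Fin m → EdgeVec n → Bool)
    (hg : ∀ i, ∀ x x' : EdgeVec n, (∀ e ∈ S i, x e = x' e) → g i x = g i x') (i : Fin m)
    {x x' : EdgeVec n} (hxx' : ∀ e ∈ (univ.filter fun j => j ≠ i).biUnion S, x e = x' e) :
    (∀ j, j ≠ i → g j x = false) ↔ (∀ j, j ≠ i → g j x' = false) := by
  have key : ∀ j, j ≠ i → g j x = g j x' := fun j hj =>
    hg j x x' fun e he =>
      hxx' e (Finset.mem_biUnion.2 ⟨j, Finset.mem_filter.2 ⟨Finset.mem_univ _, hj⟩, he⟩)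
  exact forall₂_congr fun j hj => by rw [key j hj]

/-! ### The stub -/

/-- **stub_orDisjointFamily** (M; toy accumulation for a finite family with pairwise DISJOINT supports;
stub of line `Sketch` of crux stmt-PneNP-18027). For tests `g i` determined by pairwise disjoint slot
sets `S i` and any planted set `A`: the dead–revival mass of `⋁ i, g i` at `A` is
`≤ Σ_i adv_A(g i) · Pr_x[all g j, j ≠ i, dead]` (`adv_A(f) := Pr_x[f x = false ∧ f (plant A x) = true]`):
the `∨` is revived through some child `i` while the others are dead (containment in a finite union and
the union bound), and events determined by disjoint coordinate sets are independent under `G(n,1/2)`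
(`erdosRenyiHalf_and_eq_mul_of_disjoint`). [folklore] -/
theorem stub_orDisjointFamily :
    ∀ (n m : ℕ) (A : Finset (Fin n)) (S : Fin m → Finset ((⊤ : SimpleGraph (Fin n)).edgeSet))
      (g : Fin m → EdgeVec n → Bool),
      (∀ i j, i ≠ j → Disjoint (S i) (S j)) →
      (∀ i, ∀ x x' : EdgeVec n, (∀ e ∈ S i, x e = x' e) → g i x = g i x') →
      (erdosRenyiHalf n).toOuterMeasure
          {x | (∀ i, g i x = false) ∧ ∃ i, g i (plant A x) = true} ≤
        ∑ i, (erdosRenyiHalf n).toOuterMeasure {x | g i x = false ∧ g i (plant A x) = true} *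
          (erdosRenyiHalf n).toOuterMeasure {x | ∀ j, j ≠ i → g j x = false} := by
  intro n m A S g hS hg
  -- containment: the `∨` is revived through the witness `i` of the `∃` while every child is dead
  have hsub : {x : EdgeVec n | (∀ i, g i x = false) ∧ ∃ i, g i (plant A x) = true} ⊆
      ⋃ i, {x | (g i x = false ∧ g i (plant A x) = true) ∧ ∀ j, j ≠ i → g j x = false} := by
    intro x hx
    simp only [Set.mem_setOf_eq] at hx
    obtain ⟨hdead, i, hi⟩ := hx
    exact Set.mem_iUnion.2 ⟨i, ⟨hdead i, hi⟩, fun j _ => hdead j⟩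
  -- independence: `{g i dead ∧ g i revived}` is `S i`-determined, `{others dead}` is
  -- `⋃_{j ≠ i} S j`-determined, and the two slot sets are disjoint
  have hind : ∀ i, (erdosRenyiHalf n).toOuterMeasure
      {x | (g i x = false ∧ g i (plant A x) = true) ∧ ∀ j, j ≠ i → g j x = false} =
      (erdosRenyiHalf n).toOuterMeasure {x | g i x = false ∧ g i (plant A x) = true} *
        (erdosRenyiHalf n).toOuterMeasure {x | ∀ j, j ≠ i → g j x = false} := fun i =>
    erdosRenyiHalf_and_eq_mul_of_disjoint (disjoint_biUnion_others S hS i)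
      (fun x => g i x = false ∧ g i (plant A x) = true) (fun x => ∀ j, j ≠ i → g j x = false)
      (fun x x' hxx' => by rw [hg i x x' hxx', apply_plant_congr_on A (S i) (g i) (hg i) hxx'])
      (fun x x' hxx' => forall_ne_dead_congr_of_agree S g hg i hxx')
  calc (erdosRenyiHalf n).toOuterMeasure {x | (∀ i, g i x = false) ∧ ∃ i, g i (plant A x) = true}
      ≤ (erdosRenyiHalf n).toOuterMeasure
          (⋃ i, {x | (g i x = false ∧ g i (plant A x) = true) ∧ ∀ j, j ≠ i → g j x = false}) :=
        MeasureTheory.measure_mono hsub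
    _ ≤ ∑ i, (erdosRenyiHalf n).toOuterMeasure
          {x | (g i x = false ∧ g i (plant A x) = true) ∧ ∀ j, j ≠ i → g j x = false} :=
        MeasureTheory.measure_iUnion_fintype_le _ _
    _ = _ := Finset.sum_congr rfl fun i _ => hind i

end Summit.PneNP.PneNP.Theorems.MonotoneBlind.VertexCover
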